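import Summits.SmoothPoincare4.SmoothPoincare4.Theses.RicciFat

/-!
# `RicciFat.FatBeyondWeylGap`: the hypothesis `M ≃ₕ S⁴` is load-bearing (item stmt-SmoothPoincare4-18048)

Refuter mutation analysis (crux-attack, vetting sweep 2026-08-17). The crux
`FatBeyondWeylGap` reads `∀ M (closed smooth 4-manifold), M ≃ₕ S⁴ → ∃ h, Ric_h ≥ 3h ∧ Vol(M,h) > 8π²/9`.
Dropping the homotopy-equivalence hypothesis makes it FALSE already at the cheapest junk model the
binder class admits, the EMPTY 4-manifold (`PEmpty` with Mathlib's `ChartedSpace.empty`): every metric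
on it has total Riemannian measure `0 < 8π²/9`. (On paper the nonempty witnesses are `T⁴`, `S¹ × S³`:
no metric of positive Ricci curvature by Bonnet–Myers / Bochner, infinite `π₁`; not formalised here.)
The hypothesis `M ≃ₕ S⁴` excludes the empty model (`S⁴` is nonempty), see
`nonempty_of_homotopyEquiv_sphere`. No new definition is introduced: the mutated statement is spelled
out inline.
-/

noncomputable section

-- the registered namespace `Summit.SmoothPoincare4.SmoothPoincare4.Theorems` repeats a component
set_option linter.dupNamespace false

open scoped Manifold ContDiff Topology ENNReal ContinuousMap
open Set MeasureTheory Literature.Geometry.Lorentzian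

namespace Summit.SmoothPoincare4.SmoothPoincare4.Theorems

/-- **`FatBeyondWeylGap` is false without the hypothesis `M ≃ₕ S⁴`**: the conclusion
`∃ h, Ric_h ≥ 3h ∧ Vol > 8π²/9` fails on the empty smooth 4-manifold, whose total Riemannian measure
is `0` for every metric. Any proof of the crux must therefore use the homotopy equivalence (at the
very least its consequence `Nonempty M`). [folklore] -/
theorem fatBeyondWeylGap_false_without_homotopyEquiv :
    ¬ (∀ (M : Type) [TopologicalSpace M] [T2Space M] [SecondCountableTopology M]
        [ChartedSpace (EuclideanSpace ℝ (Fin 4)) M] [IsManifold (𝓡 4) ∞ M] [CompactSpace M]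
        [MeasurableSpace M] [BorelSpace M],
        ∃ h : Bundle.ContMDiffRiemannianMetric (𝓡 4) ∞ (EuclideanSpace ℝ (Fin 4))
          (TangentSpace (𝓡 4) : M → Type _),
        ∃ _ : (PseudoRiemannianMetric.ofRiemannian h).HasLeviCivita,
          (∀ (x : M) (v : TangentSpace (𝓡 4) x),
            3 * h.inner x v v ≤ (PseudoRiemannianMetric.ofRiemannian h).ricci x v v) ∧
          ENNReal.ofReal (8 * Real.pi ^ 2 / 9) < riemannianMeasure h Set.univ) := by
  intro H
  letI : ChartedSpace (EuclideanSpace ℝ (Fin 4)) PEmpty.{1} := ChartedSpace.empty _ _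
  letI : MeasurableSpace PEmpty.{1} := borel _
  haveI : BorelSpace PEmpty.{1} := ⟨rfl⟩
  obtain ⟨h, _, _, hvol⟩ := H PEmpty.{1}
  rw [Set.univ_eq_empty_iff.mpr inferInstance, measure_empty] at hvol
  exact (not_lt_zero hvol).elim

/-- The excluded model is indeed excluded: a space homotopy equivalent to `S⁴` is nonempty.
[folklore] -/
theorem nonempty_of_homotopyEquiv_sphere {M : Type*} [TopologicalSpace M]
    (e : M ≃ₕ Metric.sphere (0 : EuclideanSpace ℝ (Fin 5)) 1) : Nonempty M :=
  ⟨e.invFun ⟨EuclideanSpace.single 0 1, by simp⟩⟩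

end Summit.SmoothPoincare4.SmoothPoincare4.Theorems

end
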